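import Literature.Analysis.UnboundedOperators.HeatKernelJointDerivatives
import Literature.Analysis.FunctionSpaces.SmoothParametricIntegralDominated
import HarnessLib

/-!
# Joint space–time smoothness of the caloric extension of `Lᵖ` data, with Gaussian bounds

Analysis/UnboundedOperators support file (everything proved). For `f ∈ Lᵖ(E; F)`,
`1 ≤ p ≤ ∞` (in particular for merely **bounded** measurable data, `p = ∞`, and for integrable
data, `p = 1`), the caloric extension `u(t, x) = e^{tΔ}f(x) = ∫ W_t(x - y) f(y) dy`
(`UnboundedOperators.heatExtension`) is **jointly `C^∞` in `(t, x)` on `(0, ∞) × E`**, its joint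
derivatives are obtained by differentiating under the integral sign,
`D^m_{(t,x)} u = ∫ (D^m_{(t,x)} W)(t, x - y) f(y) dy`, and on every compact time range
`[t₀, t₁] ⊂ (0, ∞)` they are dominated by a fixed Gaussian potential of `|f|`:
`‖D^m u(t, x)‖ ≤ C ∫ e^{-‖x-y‖²/(8t₁)} ‖f(y)‖ dy` (`exists_norm_iteratedFDeriv_heatExtension_prod_le`),
in particular `≤ C' ‖f‖_∞` for bounded data (`exists_norm_iteratedFDeriv_heatExtension_prod_le_of_bound`).
This is Evans, *PDE*, §2.3.1, Thm. 1 (i) ("`u ∈ C^∞(ℝⁿ × (0, ∞))`") for `Lᵖ` data, by the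
argument of its proof (the derivatives of the fundamental solution are bounded by Gaussians on
`[δ, ∞)`, so one may differentiate under the integral sign); the tree's
`contDiff_heatExtension_holds` is smoothness in `x` at fixed `t`, and
`contDiffOn_uncurry_heatExtension` is the joint statement for compactly supported data only.

The proof is `SmoothParametricIntegralDominated.contDiffOn_integral_of_dominated` with the joint
Gaussian envelopes of `HeatKernelJointDerivatives.lean`: near `(t₀, x₀)` the derivatives of
`(t, x) ↦ W_t(x - y) f(y)` are bounded by `C e^{1/(8t₁)} e^{-‖x₀-y‖²/(16t₁)} ‖f(y)‖`, an
integrable function of `y` for `f ∈ Lᵖ` (`integrable_gaussian_smul_of_memLp`).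

## References

* L. C. Evans, *Partial Differential Equations*, 2nd ed. (2010), §2.3.1, Thm. 1 and its proof.
* A. Friedman, *Partial Differential Equations of Parabolic Type* (1964), Ch. 1, §§6–7.
-/

noncomputable section

open MeasureTheory Set Filter Topology Function Metric
open scoped ContDiff Real ENNReal

namespace Literature.Analysis.UnboundedOperators

variable {E : Type*} [NormedAddCommGroup E] [InnerProductSpace ℝ E] [FiniteDimensional ℝ E]
  [MeasurableSpace E] [BorelSpace E]
  {F : Type*} [NormedAddCommGroup F] [NormedSpace ℝ F]

/-! ### The integrand `(t, x) ↦ W_t(x - y) f(y)` and its derivatives -/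

section Integrand

omit [FiniteDimensional ℝ E] [MeasurableSpace E] [BorelSpace E] in
/-- The translated kernel is the joint kernel composed with the translation `q ↦ q - (0, y)`.
[folklore] -/
theorem heatKernel_fst_snd_sub_eq (y : E) :
    (fun q : ℝ × E => heatKernel q.1 (q.2 - y)) =
      fun q : ℝ × E => (fun r : ℝ × E => heatKernel r.1 r.2) (q - ((0 : ℝ), y)) := by
  funext q
  simp

omit [FiniteDimensional ℝ E] [MeasurableSpace E] [BorelSpace E] in
/-- The translated kernel is smooth in `(t, x)` on the half-space. [folklore] -/
theorem contDiffOn_heatKernel_fst_snd_sub (y : E) :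
    ContDiffOn ℝ ∞ (fun q : ℝ × E => heatKernel q.1 (q.2 - y)) (Ioi 0 ×ˢ univ) := by
  rw [heatKernel_fst_snd_sub_eq y]
  refine contDiffOn_uncurry_heatKernel.comp (contDiffOn_id.sub contDiffOn_const) fun q hq => ?_
  exact mk_mem_prod (by simpa using (mem_prod.1 hq).1) (mem_univ _)

omit [FiniteDimensional ℝ E] [MeasurableSpace E] [BorelSpace E] in
/-- The translated kernel is smooth at every point of the half-space. [folklore] -/
theorem contDiffAt_heatKernel_fst_snd_sub (y : E) {p : ℝ × E} (hp : p ∈ Ioi (0 : ℝ) ×ˢ (univ : Set E)) :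
    ContDiffAt ℝ ∞ (fun q : ℝ × E => heatKernel q.1 (q.2 - y)) p :=
  (contDiffOn_heatKernel_fst_snd_sub y).contDiffAt ((isOpen_Ioi.prod isOpen_univ).mem_nhds hp)

omit [FiniteDimensional ℝ E] [MeasurableSpace E] [BorelSpace E] in
/-- **Derivatives of the integrand**: `D^m_{(t,x)} [W_t(x - y) f(y)] = (D^m W)(t, x - y) ⊗ f(y)`.
[folklore] -/
theorem iteratedFDeriv_heatKernel_sub_smul (f : E → F) (y : E) (m : ℕ) {p : ℝ × E}
    (hp : p ∈ Ioi (0 : ℝ) ×ˢ (univ : Set E)) :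
    iteratedFDeriv ℝ m (fun q : ℝ × E => heatKernel q.1 (q.2 - y) • f y) p =
      ((ContinuousLinearMap.id ℝ ℝ).smulRight (f y)).compContinuousMultilinearMap
        (iteratedFDeriv ℝ m (fun q : ℝ × E => heatKernel q.1 q.2) (p.1, p.2 - y)) := by
  rw [iteratedFDeriv_smul_const_apply
    ((contDiffAt_heatKernel_fst_snd_sub y hp).of_le (by exact_mod_cast le_top)),
    heatKernel_fst_snd_sub_eq y]
  have h2 : iteratedFDeriv ℝ m
      (fun q : ℝ × E => (fun r : ℝ × E => heatKernel r.1 r.2) (q - ((0 : ℝ), y))) p =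
      iteratedFDeriv ℝ m (fun r : ℝ × E => heatKernel r.1 r.2) (p - ((0 : ℝ), y)) :=
    iteratedFDeriv_comp_sub (f := fun r : ℝ × E => heatKernel r.1 r.2) m ((0 : ℝ), y) p
  rw [h2]
  congr 2
  ext <;> simp

omit [FiniteDimensional ℝ E] [MeasurableSpace E] [BorelSpace E] in
/-- **Size of the derivatives of the integrand**:
`‖D^m_{(t,x)} [W_t(x - y) f(y)]‖ ≤ ‖(D^m W)(t, x - y)‖ ‖f(y)‖`. [folklore] -/
theorem norm_iteratedFDeriv_heatKernel_sub_smul_le (f : E → F) (y : E) (m : ℕ) {p : ℝ × E}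
    (hp : p ∈ Ioi (0 : ℝ) ×ˢ (univ : Set E)) :
    ‖iteratedFDeriv ℝ m (fun q : ℝ × E => heatKernel q.1 (q.2 - y) • f y) p‖ ≤
      ‖iteratedFDeriv ℝ m (fun q : ℝ × E => heatKernel q.1 q.2) (p.1, p.2 - y)‖ * ‖f y‖ := by
  rw [iteratedFDeriv_heatKernel_sub_smul f y m hp]
  refine (ContinuousLinearMap.norm_compContinuousMultilinearMap_le _ _).trans ?_
  rw [ContinuousLinearMap.norm_smulRight_apply, mul_comm]
  gcongr
  calc ‖ContinuousLinearMap.id ℝ ℝ‖ * ‖f y‖ ≤ 1 * ‖f y‖ :=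
        mul_le_mul_of_nonneg_right ContinuousLinearMap.norm_id_le (norm_nonneg _)
    _ = ‖f y‖ := one_mul _

/-- **Measurability in `y` of the derivatives of the integrand** (the kernel factor is
continuous in `y`, the data factor is measurable). [folklore] -/
theorem aestronglyMeasurable_iteratedFDeriv_heatKernel_sub_smul {f : E → F}
    (hf : AEStronglyMeasurable f volume) (m : ℕ) {p : ℝ × E} (hp : p ∈ Ioi (0 : ℝ) ×ˢ (univ : Set E)) :
    AEStronglyMeasurable
      (fun y => iteratedFDeriv ℝ m (fun q : ℝ × E => heatKernel q.1 (q.2 - y) • f y) p) volume := by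
  have hp1 : 0 < p.1 := (mem_prod.1 hp).1
  have hK : Continuous fun y : E =>
      iteratedFDeriv ℝ m (fun q : ℝ × E => heatKernel q.1 q.2) (p.1, p.2 - y) := by
    refine (continuousOn_iteratedFDeriv_heatKernel_prod (E := E) m).comp_continuous
      (by fun_prop) fun y => mk_mem_prod hp1 (mem_univ _)
  have heq : (fun y => iteratedFDeriv ℝ m (fun q : ℝ × E => heatKernel q.1 (q.2 - y) • f y) p) =
      fun y => ContinuousMultilinearMap.smulRightL ℝ (fun _ : Fin m => ℝ × E) F
        (iteratedFDeriv ℝ m (fun q : ℝ × E => heatKernel q.1 q.2) (p.1, p.2 - y)) (f y) := by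
    funext y
    rw [iteratedFDeriv_heatKernel_sub_smul f y m hp]
    ext v
    simp
  rw [heq]
  exact (ContinuousMultilinearMap.smulRightL ℝ (fun _ : Fin m => ℝ × E) F).aestronglyMeasurable_comp₂
    hK.aestronglyMeasurable hf

omit [InnerProductSpace ℝ E] [FiniteDimensional ℝ E] [MeasurableSpace E] [BorelSpace E] in
/-- Gaussian comparison on a unit ball: for `‖x - x₀‖ < 1`,
`e^{-‖x - y‖²/(8t₁)} ≤ e^{1/(8t₁)} e^{-‖x₀ - y‖²/(16t₁)}` (`‖x₀ - y‖² ≤ 2‖x - y‖² + 2`).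
[folklore] -/
theorem exp_neg_norm_sub_sq_le_of_mem_ball [NormedSpace ℝ E] {t₁ : ℝ} (ht₁ : 0 < t₁)
    {x x₀ y : E} (hx : x ∈ ball x₀ 1) :
    Real.exp (-‖x - y‖ ^ 2 / (8 * t₁)) ≤
      Real.exp (1 / (8 * t₁)) * Real.exp (-(1 / (16 * t₁)) * ‖x₀ - y‖ ^ 2) := by
  rw [← Real.exp_add, Real.exp_le_exp]
  have hxx : ‖x - x₀‖ < 1 := mem_ball_iff_norm.1 hx
  have htri : ‖x₀ - y‖ ≤ ‖x - y‖ + ‖x - x₀‖ := by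
    calc ‖x₀ - y‖ = ‖(x - y) - (x - x₀)‖ := by congr 1; abel
      _ ≤ ‖x - y‖ + ‖x - x₀‖ := norm_sub_le _ _
  have hb : ‖x₀ - y‖ ≤ ‖x - y‖ + 1 := by linarith
  have hsq : ‖x₀ - y‖ ^ 2 ≤ 2 * ‖x - y‖ ^ 2 + 2 := by
    have h2 : ‖x₀ - y‖ ^ 2 ≤ (‖x - y‖ + 1) ^ 2 := pow_le_pow_left₀ (norm_nonneg _) hb 2
    nlinarith [sq_nonneg (‖x - y‖ - 1)]
  have e1 : -‖x - y‖ ^ 2 / (8 * t₁) = (-2 * ‖x - y‖ ^ 2) / (16 * t₁) := by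
    field_simp
    ring
  have e2 : 1 / (8 * t₁) + -(1 / (16 * t₁)) * ‖x₀ - y‖ ^ 2 = (2 - ‖x₀ - y‖ ^ 2) / (16 * t₁) := by
    field_simp
    ring
  rw [e1, e2]
  exact div_le_div_of_nonneg_right (by linarith) (by positivity)

end Integrand

/-! ### Joint smoothness and Gaussian bounds -/

section Main

/-- **The hypotheses of the dominated `C^∞` lemma for the caloric integrand.** For `f ∈ Lᵖ`,
`1 ≤ p ≤ ∞`: smoothness in `(t, x)`, measurability of the derivatives in `y`, and local
domination of every derivative by an integrable function (the joint Gaussian envelope of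
`HeatKernelJointDerivatives.lean`, transferred to a unit ball around the base point).
[folklore] -/
theorem heatExtension_dominated_hypotheses {f : E → F} {p : ℝ≥0∞} (hf : MemLp f p volume) (hp : 1 ≤ p) :
    (∀ᵐ y ∂(volume : Measure E), ContDiffOn ℝ ∞ (fun q : ℝ × E => heatKernel q.1 (q.2 - y) • f y) (Ioi 0 ×ˢ univ)) ∧
    (∀ m : ℕ, ∀ q ∈ Ioi (0 : ℝ) ×ˢ (univ : Set E), AEStronglyMeasurable
      (fun y => iteratedFDeriv ℝ m (fun r : ℝ × E => heatKernel r.1 (r.2 - y) • f y) q) volume) ∧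
    (∀ m : ℕ, ∀ q₀ ∈ Ioi (0 : ℝ) ×ˢ (univ : Set E), ∃ ε > 0, ∃ g : E → ℝ, Integrable g volume ∧
      ∀ᵐ y ∂(volume : Measure E), ∀ q ∈ ball q₀ ε,
        ‖iteratedFDeriv ℝ m (fun r : ℝ × E => heatKernel r.1 (r.2 - y) • f y) q‖ ≤ g y) := by
  refine ⟨Eventually.of_forall fun y => (contDiffOn_heatKernel_fst_snd_sub y).smul contDiffOn_const,
    fun m q hq => aestronglyMeasurable_iteratedFDeriv_heatKernel_sub_smul hf.1 m hq, ?_⟩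
  intro m q₀ hq₀
  have ht₀ : 0 < q₀.1 := (mem_prod.1 hq₀).1
  -- time range `[t₀/2, t₀ + 1]` and the ball of radius `min (t₀/2) 1`
  set a : ℝ := q₀.1 / 2 with ha
  set b : ℝ := q₀.1 + 1 with hb
  have ha0 : 0 < a := by positivity
  have hab : a ≤ b := by rw [ha, hb]; linarith
  have hb0 : 0 < b := ha0.trans_le hab
  obtain ⟨C, hC, henv⟩ := exists_norm_iteratedFDeriv_heatKernel_prod_le_exp (E := E) m ha0 hab
  set ε : ℝ := min a 1 with hε
  have hε0 : 0 < ε := lt_min ha0 one_pos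
  refine ⟨ε, hε0, fun y => C * Real.exp (1 / (8 * b)) *
    (Real.exp (-(1 / (16 * b)) * ‖q₀.2 - y‖ ^ 2) * ‖f y‖), ?_, ?_⟩
  · have hi := integrable_gaussian_smul_of_memLp (by positivity : (0 : ℝ) < 1 / (16 * b)) q₀.2
      hf.norm hp
    simp only [smul_eq_mul] at hi
    exact hi.const_mul _
  · refine Eventually.of_forall fun y q hq => ?_
    have hq' : dist q q₀ < ε := mem_ball.1 hq
    have hd1 : dist q.1 q₀.1 ≤ dist q q₀ := by rw [Prod.dist_eq]; exact le_max_left _ _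
    have hd2 : dist q.2 q₀.2 ≤ dist q q₀ := by rw [Prod.dist_eq]; exact le_max_right _ _
    have hqt : |q.1 - q₀.1| < ε := by
      rw [← Real.dist_eq]
      exact hd1.trans_lt hq'
    have hqx : q.2 ∈ ball q₀.2 1 := by
      rw [mem_ball]
      exact hd2.trans_lt (hq'.trans_le (min_le_right _ _))
    have hta : q.1 ∈ Icc a b := by
      have h1 : ε ≤ a := min_le_left _ _
      have h2 : ε ≤ 1 := min_le_right _ _
      constructor
      · rw [ha]; linarith [(abs_lt.1 hqt).1]
      · rw [hb]; linarith [(abs_lt.1 hqt).2]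
    have hq1 : 0 < q.1 := ha0.trans_le hta.1
    have hqU : q ∈ Ioi (0 : ℝ) ×ˢ (univ : Set E) := mk_mem_prod hq1 (mem_univ _)
    calc ‖iteratedFDeriv ℝ m (fun r : ℝ × E => heatKernel r.1 (r.2 - y) • f y) q‖
        ≤ ‖iteratedFDeriv ℝ m (fun r : ℝ × E => heatKernel r.1 r.2) (q.1, q.2 - y)‖ * ‖f y‖ :=
          norm_iteratedFDeriv_heatKernel_sub_smul_le f y m hqU
      _ ≤ (C * Real.exp (-‖q.2 - y‖ ^ 2 / (8 * b))) * ‖f y‖ :=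
          mul_le_mul_of_nonneg_right (henv q.1 hta (q.2 - y)) (norm_nonneg _)
      _ ≤ (C * (Real.exp (1 / (8 * b)) * Real.exp (-(1 / (16 * b)) * ‖q₀.2 - y‖ ^ 2))) * ‖f y‖ := by
          gcongr
          exact exp_neg_norm_sub_sq_le_of_mem_ball hb0 hqx
      _ = _ := by ring

/-- The caloric extension as the parametric integral of the translated kernel. [folklore] -/
theorem heatExtension_prod_eq_integral (f : E → F) :
    (fun q : ℝ × E => heatExtension f q.1 q.2) = fun q : ℝ × E => ∫ y, heatKernel q.1 (q.2 - y) • f y :=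
  funext fun q => heatExtension_eq_integral_sub f q.1 q.2

/-- **Joint smoothness of the caloric extension of `Lᵖ` data** (Evans, §2.3.1, Thm. 1 (i), for
`f ∈ Lᵖ`, `1 ≤ p ≤ ∞`): `(t, x) ↦ e^{tΔ}f(x)` is `C^∞` on `(0, ∞) × E`. [folklore] -/
theorem contDiffOn_heatExtension_prod {f : E → F} {p : ℝ≥0∞} (hf : MemLp f p volume) (hp : 1 ≤ p) :
    ContDiffOn ℝ ∞ (fun q : ℝ × E => heatExtension f q.1 q.2) (Ioi 0 ×ˢ univ) := by
  obtain ⟨h1, h2, h3⟩ := heatExtension_dominated_hypotheses hf hp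
  rw [heatExtension_prod_eq_integral]
  exact FunctionSpaces.contDiffOn_integral_of_dominated (isOpen_Ioi.prod isOpen_univ) h1 h2 h3

/-- **Derivatives of the caloric extension under the integral sign**:
`D^m_{(t,x)} e^{tΔ}f(x) = ∫ D^m_{(t,x)} [W_t(x - y) f(y)] dy` on the half-space. [folklore] -/
theorem iteratedFDeriv_heatExtension_prod_eq_integral {f : E → F} {p : ℝ≥0∞} (hf : MemLp f p volume)
    (hp : 1 ≤ p) (m : ℕ) {q : ℝ × E} (hq : q ∈ Ioi (0 : ℝ) ×ˢ (univ : Set E)) :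
    iteratedFDeriv ℝ m (fun r : ℝ × E => heatExtension f r.1 r.2) q =
      ∫ y, iteratedFDeriv ℝ m (fun r : ℝ × E => heatKernel r.1 (r.2 - y) • f y) q := by
  obtain ⟨h1, h2, h3⟩ := heatExtension_dominated_hypotheses hf hp
  rw [heatExtension_prod_eq_integral]
  exact FunctionSpaces.iteratedFDeriv_integral_of_dominated (isOpen_Ioi.prod isOpen_univ) h1 h2 h3 m hq

/-- **Gaussian bound for the joint derivatives of the caloric extension**: for every `m` and
every compact time range `[t₀, t₁] ⊂ (0, ∞)` there is `C ≥ 0` (depending only on `m, t₀, t₁`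
and `E`) such that for all `f ∈ Lᵖ`, `1 ≤ p ≤ ∞`, `t ∈ [t₀, t₁]` and `x`,
`‖D^m_{(t,x)} e^{tΔ}f (x)‖ ≤ C ∫ e^{-‖x - y‖²/(8t₁)} ‖f(y)‖ dy` (Evans, §2.3.1, proof of Thm. 1:
the derivatives of the fundamental solution are bounded by Gaussians on `[δ, ∞)`). [folklore] -/
theorem exists_norm_iteratedFDeriv_heatExtension_prod_le (m : ℕ) {t₀ t₁ : ℝ} (ht₀ : 0 < t₀)
    (h01 : t₀ ≤ t₁) :
    ∃ C : ℝ, 0 ≤ C ∧ ∀ {f : E → F} {p : ℝ≥0∞}, MemLp f p volume → 1 ≤ p →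
      ∀ t ∈ Icc t₀ t₁, ∀ x : E,
        ‖iteratedFDeriv ℝ m (fun r : ℝ × E => heatExtension f r.1 r.2) (t, x)‖ ≤
          C * ∫ y, Real.exp (-‖x - y‖ ^ 2 / (8 * t₁)) * ‖f y‖ := by
  obtain ⟨C, hC, henv⟩ := exists_norm_iteratedFDeriv_heatKernel_prod_le_exp (E := E) m ht₀ h01
  refine ⟨C, hC, fun {f p} hf hp t ht x => ?_⟩
  have ht₁ : 0 < t₁ := ht₀.trans_le h01
  obtain ⟨h1, h2, h3⟩ := heatExtension_dominated_hypotheses hf hp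
  have hq : ((t, x) : ℝ × E) ∈ Ioi (0 : ℝ) ×ˢ (univ : Set E) :=
    mk_mem_prod (ht₀.trans_le ht.1) (mem_univ _)
  have hint : Integrable (fun y => Real.exp (-‖x - y‖ ^ 2 / (8 * t₁)) * ‖f y‖) := by
    have hi := integrable_gaussian_smul_of_memLp (by positivity : (0 : ℝ) < 1 / (8 * t₁)) x hf.norm hp
    simp only [smul_eq_mul] at hi
    refine hi.congr (Eventually.of_forall fun y => ?_)
    simp only [neg_mul, one_div, neg_div]
    rw [div_eq_inv_mul]
  rw [heatExtension_prod_eq_integral]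
  have h := FunctionSpaces.norm_iteratedFDeriv_integral_le_of_le (isOpen_Ioi.prod isOpen_univ) h1 h2 h3 m hq
    (hint.const_mul C) (Eventually.of_forall fun y => ?_)
  · rw [integral_const_mul] at h
    exact h
  · calc ‖iteratedFDeriv ℝ m (fun r : ℝ × E => heatKernel r.1 (r.2 - y) • f y) (t, x)‖
        ≤ ‖iteratedFDeriv ℝ m (fun r : ℝ × E => heatKernel r.1 r.2) (t, x - y)‖ * ‖f y‖ :=
          norm_iteratedFDeriv_heatKernel_sub_smul_le f y m hq
      _ ≤ (C * Real.exp (-‖x - y‖ ^ 2 / (8 * t₁))) * ‖f y‖ :=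
          mul_le_mul_of_nonneg_right (henv t ht (x - y)) (norm_nonneg _)
      _ = C * (Real.exp (-‖x - y‖ ^ 2 / (8 * t₁)) * ‖f y‖) := by ring

omit [NormedSpace ℝ F] in
/-- The Gaussian potential of a bounded function: `∫ e^{-‖x-y‖²/(8t₁)} ‖f(y)‖ dy ≤ M ∫ e^{-‖z‖²/(8t₁)} dz`
when `‖f‖ ≤ M` a.e. [folklore] -/
theorem integral_exp_mul_norm_le_of_ae_bound {f : E → F}
    {M : ℝ} (hfM : ∀ᵐ y ∂(volume : Measure E), ‖f y‖ ≤ M) {t₁ : ℝ} (ht₁ : 0 < t₁) (x : E) :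
    ∫ y, Real.exp (-‖x - y‖ ^ 2 / (8 * t₁)) * ‖f y‖ ≤
      M * ∫ z : E, Real.exp (-‖z‖ ^ 2 / (8 * t₁)) := by
  have hG : Integrable (fun z : E => Real.exp (-‖z‖ ^ 2 / (8 * t₁))) := by
    have h := integrable_gaussian_of_pos (E := E) (by positivity : (0 : ℝ) < 1 / (8 * t₁))
    refine h.congr (Eventually.of_forall fun z => ?_)
    simp only [neg_mul, one_div, neg_div]
    rw [div_eq_inv_mul]
  have hGx : Integrable (fun y : E => Real.exp (-‖x - y‖ ^ 2 / (8 * t₁))) :=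
    (Measure.measurePreserving_sub_left volume x).integrable_comp_of_integrable hG
  calc ∫ y, Real.exp (-‖x - y‖ ^ 2 / (8 * t₁)) * ‖f y‖
      ≤ ∫ y, Real.exp (-‖x - y‖ ^ 2 / (8 * t₁)) * M := by
        refine integral_mono_of_nonneg (Eventually.of_forall fun y => by positivity) (hGx.mul_const M) ?_
        filter_upwards [hfM] with y hy
        exact mul_le_mul_of_nonneg_left hy (Real.exp_pos _).le
    _ = M * ∫ y, Real.exp (-‖x - y‖ ^ 2 / (8 * t₁)) := by rw [integral_mul_const, mul_comm]
    _ = M * ∫ z : E, Real.exp (-‖z‖ ^ 2 / (8 * t₁)) := by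
        congr 1
        exact integral_sub_left_eq_self (fun z : E => Real.exp (-‖z‖ ^ 2 / (8 * t₁))) volume x

/-- **Bounded data**: for every `m` and `[t₀, t₁] ⊂ (0, ∞)` there is `C ≥ 0` such that for every
bounded measurable `f` with `‖f‖ ≤ M` a.e. (`0 ≤ M`), `t ∈ [t₀, t₁]` and `x`,
`‖D^m_{(t,x)} e^{tΔ}f (x)‖ ≤ C M` (Evans, §2.3.1, proof of Thm. 1). [folklore] -/
theorem exists_norm_iteratedFDeriv_heatExtension_prod_le_of_bound (m : ℕ) {t₀ t₁ : ℝ} (ht₀ : 0 < t₀)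
    (h01 : t₀ ≤ t₁) :
    ∃ C : ℝ, 0 ≤ C ∧ ∀ {f : E → F} {M : ℝ}, AEStronglyMeasurable f volume → 0 ≤ M →
      (∀ᵐ y ∂(volume : Measure E), ‖f y‖ ≤ M) → ∀ t ∈ Icc t₀ t₁, ∀ x : E,
        ‖iteratedFDeriv ℝ m (fun r : ℝ × E => heatExtension f r.1 r.2) (t, x)‖ ≤ C * M := by
  have ht₁ : 0 < t₁ := ht₀.trans_le h01
  obtain ⟨C, hC, hb⟩ := exists_norm_iteratedFDeriv_heatExtension_prod_le (E := E) (F := F) m ht₀ h01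
  set I : ℝ := ∫ z : E, Real.exp (-‖z‖ ^ 2 / (8 * t₁)) with hI
  have hI0 : 0 ≤ I := integral_nonneg fun z => (Real.exp_pos _).le
  refine ⟨C * I, by positivity, fun {f M} hfm hM hfM t ht x => ?_⟩
  have hmem : MemLp f ∞ volume := memLp_top_of_bound hfm M hfM
  calc ‖iteratedFDeriv ℝ m (fun r : ℝ × E => heatExtension f r.1 r.2) (t, x)‖
      ≤ C * ∫ y, Real.exp (-‖x - y‖ ^ 2 / (8 * t₁)) * ‖f y‖ := hb hmem le_top t ht x
    _ ≤ C * (M * I) := mul_le_mul_of_nonneg_left (integral_exp_mul_norm_le_of_ae_bound hfM ht₁ x) hC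
    _ = C * I * M := by ring

end Main

end Literature.Analysis.UnboundedOperators

end
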